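import Mathlib
import HarnessLib
import Summits.NavierStokesRegularity.NavierStokesRegularity.Theses.LocalTraceTubeDoor
import Summits.NavierStokesRegularity.NavierStokesRegularity.Theorems.LocalTraceTubeDoorTarget

/-!
# Route `LocalTraceTubeDoor` (nsreg-p1 ROUND-13 door S14 «trace-square / harmonic-pressure window») — birth closer: `TraceSquareWindowRigidity`

Moot-by-proof closer (nsreg-p6 g9, DIRECTOR-NS g8 #34): the item text is closed BY NAME against the landed theorems of
`Theorems/LocalTraceTubeDoor{HarmonicOscillation,ProfileRigidity,Target}` (p519256 / p519994 / p520765; index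
HOME/ns-regularity-ideate-p6/KIT-INDEX-g9.md §A); statements are nsreg-p1's r13/Sketch13 texts.
WHAT THIS IS NOT: not NS regularity — a CONDITIONAL one-window door under LOCAL Type I.
-/

noncomputable section

-- the summit and its single sub-problem share the name (CONVENTIONS §1)
set_option linter.dupNamespace false

namespace Summit.NavierStokesRegularity.NavierStokesRegularity.Theorems.LocalTraceTubeDoorWindowClose

/-- **Item `TraceSquareWindowRigidity` of route `LocalTraceTubeDoor` holds** — by the landed theorem(s), verbatim. -/
theorem window_proof : Summit.NavierStokesRegularity.NavierStokesRegularity.Theses.LocalTraceTubeDoor.TraceSquareWindowRigidity :=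
  Summit.NavierStokesRegularity.NavierStokesRegularity.Theorems.LocalTraceTubeDoorProfileRigidity.traceSquareWindowRigidity

end Summit.NavierStokesRegularity.NavierStokesRegularity.Theorems.LocalTraceTubeDoorWindowClose

end
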